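import Mathlib
import Literature.Analysis.FluidPDE.GaussianVortexPlanar
import Literature.Analysis.FluidPDE.GaussianVortexPlanarProofs
import Literature.Analysis.FluidPDE.GaussianVortexLinearLamGap
import Summits.AnomalousDissipation.AnomalousDissipation.Theorems.MarginalStabilityChainStretchedVortexRowsStubCoreInverseTools
import Summits.AnomalousDissipation.AnomalousDissipation.Theorems.MarginalStabilityChainStretchedVortexRowsStubCoreRotationLocalSkew
import Summits.AnomalousDissipation.AnomalousDissipation.Theorems.MarginalStabilityChainStretchedVortexRowsStubCoreBiotSavartSkew
import Summits.AnomalousDissipation.AnomalousDissipation.Theorems.MarginalStabilityChainStretchedVortexRowsStubCoreLAngularPairing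
import Summits.AnomalousDissipation.AnomalousDissipation.Theorems.MarginalStabilityChainStretchedVortexRowsStubCoreLEnergyGap
import Summits.AnomalousDissipation.AnomalousDissipation.Theorems.MarginalStabilityChainStretchedVortexRowsStubCoreInverseAlgebra
import Summits.AnomalousDissipation.AnomalousDissipation.Theorems.MarginalStabilityChainStretchedVortexRowsStubLamBPairingDtheta
import Summits.AnomalousDissipation.AnomalousDissipation.Theorems.MarginalStabilityChainStretchedVortexRowsStubCoreStrainPairing
import Summits.AnomalousDissipation.AnomalousDissipation.Theorems.MarginalStabilityChainStretchedVortexRowsStubCoreInverseIntegrability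
import Summits.AnomalousDissipation.AnomalousDissipation.Theorems.MarginalStabilityChainStretchedVortexRowsStubCoreRotationCoercivity
import Summits.AnomalousDissipation.AnomalousDissipation.Theorems.MarginalStabilityChainStretchedVortexRowsStubLamBPairingW
import HarnessLib

/-!
# Stub `stub_coreInverse` of the line `braid-closed-large-circulation-gluing` (crux stmt-AnomalousDissipation-3009,
# `MarginalStabilityChain.StretchedVortexRows`): the CORE A-PRIORI BOUND, UNIFORM IN THE CIRCULATION

THE LOAD-BEARING BET of the line. For the cut-off core operator at the Gaussian vortex in ground-state variables,
`f = 𝓛w = Lw + Sw − αΛ_G w − Λ_B w`, `w = G u` even and mean-zero (`u ∈ C²`, `u, Du, D²u` bounded), with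
`L = Δ + ½ξ·∇ + 1`, `Sw = χ⟪Bξ, ∇w⟫ + ⟪∇χ, Bξ⟫w` (trace-free strain `|B| ≤ β` cut off radially at `R ≤ |α|^δ/K`),
`Λ_G w = ⟪v^G, ∇w⟫ + ⟪K∗w, ∇G⟫`, `Λ_B w = ⟪K∗w, ∇w_B⟫ + ⟪K∗w_B, ∇w⟫` (even Gaussian-class background `w_B`), one has
`w ∈ Y`, `(1+|ξ|²)^{1/2} f ∈ L²(G⁻¹)` and  **`‖w‖²_Y ≤ K² ∫ G⁻¹(1+|ξ|²) f²`**  for `|α| ≥ R₀(k, β, C_B)` — with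
`K = 1500`, `δ = 1/12`, `R₀ = (1 + 138(80|β| + C₄)(40|β| + C₃) + (40|β| + C₃)²)¹²` (`C₃, C₄` the background constants).

ENERGY METHOD AT SPECTRAL PARAMETER 0 (lead): pair `f` with `w` and with the angular derivative `∂_θw = Dw[ξ^⊥]` in `X = L²(G⁻¹)`:
* `⟨Lw, w⟩_X = −∫G|∇u|²`, gap `½∫Gu² ≤ ∫G|∇u|²`, `‖w‖²_Y ≤ 16(∫G|∇u|² + ∫Gu²)` (`coreL_energy_gap`);
* `⟨Λ_G w, w⟩_X = 0` (`coreRotation_local_skew`, `coreBiotSavart_skew`); `⟨Lw, ∂_θw⟩_X = 0` (`coreL_angular_pairing_eq_zero`);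
* ROTATION COERCIVITY `⟨Λ_G w, ∂_θw⟩_X ≥ (3/10)Θ`, `Θ = ∫G⁻¹Ω(∂_θw)²`: the local part is `Θ` pointwise
  (`inner_gaussVortexVelocity_gradient_eq_mul_angularDeriv`), the Biot–Savart part is `−½J` with `0 ≤ J ≤ (7/5)Θ`
  (`coreRotation_coercivity`: `J = ‖∇N∗∂_θw‖²`, Hardy–Wirtinger for even circular-mean-free functions, `8x²/(eˣ−1) ≤ 5.6`);
* cross terms, each `≤ C ‖w‖ Θ^{1/2}`: strain (`coreStrain_pairing_bounds`, `40βR³`, `80βR²`), background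
  (`lamB_pairing_w_bound` — the radial↔radial block vanishes —, `lamB_pairing_dtheta_bound`);
* data pairings and all integrability (`coreInverse_integrability`);
* Schur absorption of the two inequalities for `138 A′B′ ≤ |α|`, `B′² ≤ |α|` (`coreInverse_absorb′`, `coreInverse_bookkeeping`,
  `coreInverse_params`).
References: Th. Gallay, C. E. Wayne, Comm. Math. Phys. 255 (2005) §4; Th. Gallay, Arch. Ration. Mech. Anal. 200 (2011) §3
(fast-rotation limit); T. Li, D. Wei, Z. Zhang, arXiv:1701.06269 (pseudospectral bound — NOT needed here at spectral parameter 0).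
-/

set_option linter.dupNamespace false

noncomputable section

open scoped RealInnerProductSpace Topology ContDiff Laplacian
open MeasureTheory WithLp Function Metric Filter Set

namespace Summit.AnomalousDissipation.AnomalousDissipation.Theorems.MarginalStabilityChainStretchedVortexRows

open Literature.Analysis.FluidPDE

/-- **Schur absorption, variant with rotation coercivity `3/10`** (pure algebra; as `coreInverse_absorb` with the constants of the
corrected coercivity `⟨Λ_G w, ∂_θw⟩ ≥ (3/10)Θ`). [folklore] -/
theorem coreInverse_absorb' : ∀ (E Z T z φ a A' B' : ℝ) (hz : 0 ≤ z) (hφ : 0 ≤ φ) (ha : 0 < a)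
    (hA : 0 ≤ A') (hB : 0 ≤ B') (hzZ : z ^ 2 = Z) (hgap : Z ≤ 3 * E)
    (hP1 : E ≤ φ * z + B' * z * T) (hP2 : 3 / 10 * a * T ^ 2 ≤ 4 * φ * z + 4 * A' * z * T)
    (hAB : 138 * (A' * B') ≤ a) (hBa : B' ^ 2 ≤ a),
    Z ≤ 136000 * φ ^ 2 := by
  intro E Z T z φ a A' B' hz hφ ha hA hB hzZ hgap hP1 hP2 hAB hBa
  have h1 : 4 * A' * z * T ≤ 3 / 20 * a * T ^ 2 + (4 * A' * z) ^ 2 / (3 / 5 * a) := by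
    rw [← sub_nonneg]
    have key : 3 / 20 * a * T ^ 2 + (4 * A' * z) ^ 2 / (3 / 5 * a) - 4 * A' * z * T =
        (3 / 20 * a) * (T - 4 * A' * z / (3 / 10 * a)) ^ 2 := by
      field_simp
      ring
    rw [key]
    positivity
  have hT2 : T ^ 2 ≤ 80 / 3 * (φ * z) / a + 1600 / 9 * (A' ^ 2 * Z) / a ^ 2 := by
    have h2 : 3 / 20 * a * T ^ 2 ≤ 4 * φ * z + (4 * A' * z) ^ 2 / (3 / 5 * a) := by linarith
    have h3 : T ^ 2 ≤ (4 * φ * z + (4 * A' * z) ^ 2 / (3 / 5 * a)) / (3 / 20 * a) := by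
      rw [le_div_iff₀ (by positivity)]; linarith
    calc T ^ 2 ≤ (4 * φ * z + (4 * A' * z) ^ 2 / (3 / 5 * a)) / (3 / 20 * a) := h3
      _ = 80 / 3 * (φ * z) / a + 1600 / 9 * (A' ^ 2 * Z) / a ^ 2 := by
        rw [← hzZ]; field_simp; ring
  have hE : E ≤ φ * z + Z / 12 + 3 * B' ^ 2 * T ^ 2 := by
    have hy : B' * z * T ≤ Z / 12 + 3 * B' ^ 2 * T ^ 2 := by
      rw [← hzZ]
      nlinarith [sq_nonneg (z - 6 * B' * T), sq_nonneg z]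
    linarith
  have hφz : 0 ≤ φ * z := mul_nonneg hφ hz
  have hZ0 : 0 ≤ Z := by rw [← hzZ]; positivity
  have hB2T2 : B' ^ 2 * T ^ 2 ≤ 80 / 3 * (φ * z) + 1600 / 9 * (A' ^ 2 * B' ^ 2 * Z) / a ^ 2 := by
    have := mul_le_mul_of_nonneg_left hT2 (sq_nonneg B')
    have e1 : B' ^ 2 * (80 / 3 * (φ * z) / a) ≤ 80 / 3 * (φ * z) := by
      rw [show B' ^ 2 * (80 / 3 * (φ * z) / a) = (B' ^ 2 / a) * (80 / 3 * (φ * z)) by ring]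
      have : B' ^ 2 / a ≤ 1 := by rw [div_le_one ha]; exact hBa
      nlinarith
    have e2 : B' ^ 2 * (1600 / 9 * (A' ^ 2 * Z) / a ^ 2) = 1600 / 9 * (A' ^ 2 * B' ^ 2 * Z) / a ^ 2 := by
      ring
    nlinarith
  have hAB2 : A' ^ 2 * B' ^ 2 / a ^ 2 ≤ 1 / 138 ^ 2 := by
    have hABnn : 0 ≤ A' * B' := mul_nonneg hA hB
    have : (A' * B') / a ≤ 1 / 138 := by
      rw [div_le_div_iff₀ ha (by norm_num)]; linarith
    have h' : (A' * B' / a) ^ 2 ≤ (1 / 138) ^ 2 := pow_le_pow_left₀ (by positivity) this 2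
    calc A' ^ 2 * B' ^ 2 / a ^ 2 = (A' * B' / a) ^ 2 := by ring
      _ ≤ (1 / 138) ^ 2 := h'
      _ = 1 / 138 ^ 2 := by norm_num
  have hZ1 : Z ≤ 3 * (φ * z) + Z / 4 + 9 * (80 / 3 * (φ * z) + 1600 / 9 * (A' ^ 2 * B' ^ 2 * Z) / a ^ 2) := by
    nlinarith
  have hcross : 1600 / 9 * (A' ^ 2 * B' ^ 2 * Z) / a ^ 2 ≤ 1600 / 9 / 138 ^ 2 * Z := by
    have : 1600 / 9 * (A' ^ 2 * B' ^ 2 * Z) / a ^ 2 = 1600 / 9 * (A' ^ 2 * B' ^ 2 / a ^ 2) * Z := by ring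
    rw [this]
    nlinarith
  -- `Z (1 − 1/4 − 1600/138²) ≤ 243 φ z`, i.e. `0.666 Z ≤ 243 φ z`
  have hZ2 : 33 / 50 * Z ≤ 243 * (φ * z) := by nlinarith
  have hz368 : z ≤ 3685 / 10 * φ := by
    rw [← hzZ] at hZ2
    by_contra hcon
    push Not at hcon
    nlinarith
  calc Z = z ^ 2 := hzZ.symm
    _ ≤ (3685 / 10 * φ) ^ 2 := pow_le_pow_left₀ hz hz368 2
    _ ≤ 136000 * φ ^ 2 := by nlinarith [sq_nonneg φ]

/-- **Bookkeeping** (pure algebra): the values and bounds of the individual pairings, the linearity of the two energy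
identities and the rotation coercivity combine, through `coreInverse_absorb`, into `‖w‖²_Y ≤ 1500² ‖f‖²`. [folklore] -/
theorem coreInverse_bookkeeping : ∀ (E Nu N D Y Θ J F ISw ISθ IBw IBθ Ifw Ifθ α β' R C₃ C₄ : ℝ)
    (hNNu : N = Nu) (hE : 0 ≤ E) (hNu : 0 ≤ Nu) (hD : 0 ≤ D) (hΘ : 0 ≤ Θ) (hF : 0 ≤ F)
    (hβ : 0 ≤ β') (hC₃ : 0 ≤ C₃) (hC₄ : 0 ≤ C₄) (hR : 1 ≤ R)
    (hY : Y = N + D) (hY16 : Y ≤ 16 * (E + Nu)) (hgap : 1 / 2 * Nu ≤ E)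
    (hfw : Ifw = -E + ISw - α * (0 + 0) - IBw) (hfθ : Ifθ = 0 + ISθ - α * (Θ + -(1 / 2) * J) - IBθ)
    (hJ0 : 0 ≤ J) (hJ : J ≤ 7 / 5 * Θ)
    (hSw : |ISw| ≤ 40 * β' * R ^ 3 * Real.sqrt N * Real.sqrt Θ)
    (hSθ : |ISθ| ≤ 80 * β' * R ^ 2 * Real.sqrt Y * Real.sqrt Θ)
    (hBw : |IBw| ≤ C₃ * Real.sqrt (E + Nu) * Real.sqrt Θ) (hBθ : |IBθ| ≤ C₄ * Real.sqrt Y * Real.sqrt Θ)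
    (hPfw : |Ifw| ≤ Real.sqrt F * Real.sqrt N) (hPfθ : |Ifθ| ≤ Real.sqrt F * Real.sqrt D)
    (hAB : 138 * ((80 * β' * R ^ 2 + C₄) * (40 * β' * R ^ 3 + C₃)) ≤ |α|)
    (hBa : (40 * β' * R ^ 3 + C₃) ^ 2 ≤ |α|) (ha : 0 < |α|),
    Y ≤ 1500 ^ 2 * F := by
  intro E Nu N D Y Θ J F ISw ISθ IBw IBθ Ifw Ifθ α β' R C₃ C₄ hNNu hE hNu hD hΘ hF hβ hC₃ hC₄ hR hY hY16 hgap
    hfw hfθ hJ0 hJ hSw hSθ hBw hBθ hPfw hPfθ hAB hBa ha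
  rw [hNNu] at hY hSw hPfw
  -- the square roots
  set z : ℝ := Real.sqrt (E + Nu) with hz
  set T : ℝ := Real.sqrt Θ with hT
  set φ : ℝ := Real.sqrt F with hφ
  have hz0 : 0 ≤ z := Real.sqrt_nonneg _
  have hT0 : 0 ≤ T := Real.sqrt_nonneg _
  have hφ0 : 0 ≤ φ := Real.sqrt_nonneg _
  have hZ0 : 0 ≤ E + Nu := by positivity
  have hzZ : z ^ 2 = E + Nu := Real.sq_sqrt hZ0
  have hTΘ : T ^ 2 = Θ := Real.sq_sqrt hΘ
  have hφF : φ ^ 2 = F := Real.sq_sqrt hF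
  have hN0 : 0 ≤ Nu := hNu
  have hY0 : 0 ≤ Y := by rw [hY]; positivity
  -- `√N ≤ z`, `√D ≤ √Y ≤ 4 z`
  have hsN : Real.sqrt Nu ≤ z := Real.sqrt_le_sqrt (by linarith)
  have hsD : Real.sqrt D ≤ Real.sqrt Y := Real.sqrt_le_sqrt (by rw [hY]; linarith [Real.sqrt_nonneg Nu])
  have hsY : Real.sqrt Y ≤ 4 * z := by
    calc Real.sqrt Y ≤ Real.sqrt (16 * (E + Nu)) := Real.sqrt_le_sqrt hY16
      _ = 4 * z := by
        rw [Real.sqrt_mul (by norm_num), show (16 : ℝ) = 4 ^ 2 by norm_num, Real.sqrt_sq (by norm_num)]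
  have hsD4 : Real.sqrt D ≤ 4 * z := hsD.trans hsY
  set A' : ℝ := 80 * β' * R ^ 2 + C₄ with hA'
  set B' : ℝ := 40 * β' * R ^ 3 + C₃ with hB'
  have hR0 : 0 ≤ R := by linarith
  have hA'0 : 0 ≤ A' := by positivity
  have hB'0 : 0 ≤ B' := by positivity
  -- (P1): `E ≤ φ z + B' z T`
  have hP1 : E ≤ φ * z + B' * z * T := by
    have h1 : E = -Ifw + ISw - IBw := by rw [hfw]; ring
    have h2 : -Ifw ≤ φ * z := by
      calc -Ifw ≤ |Ifw| := neg_le_abs Ifw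
        _ ≤ φ * Real.sqrt Nu := hPfw
        _ ≤ φ * z := mul_le_mul_of_nonneg_left hsN hφ0
    have h3 : ISw ≤ 40 * β' * R ^ 3 * z * T := by
      calc ISw ≤ |ISw| := le_abs_self ISw
        _ ≤ 40 * β' * R ^ 3 * Real.sqrt Nu * T := hSw
        _ ≤ 40 * β' * R ^ 3 * z * T := by gcongr
    have h4 : -IBw ≤ C₃ * z * T := by
      calc -IBw ≤ |IBw| := neg_le_abs IBw
        _ ≤ C₃ * z * T := hBw
    calc E = -Ifw + ISw - IBw := h1
      _ ≤ φ * z + 40 * β' * R ^ 3 * z * T + C₃ * z * T := by linarith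
      _ = φ * z + B' * z * T := by rw [hB']; ring
  -- (P2): `(3/10)|α| Θ ≤ 4 φ z + 4 A' z T`
  have hP2 : 3 / 10 * |α| * T ^ 2 ≤ 4 * φ * z + 4 * A' * z * T := by
    have hcoer : 3 / 10 * Θ ≤ Θ + -(1 / 2) * J := by linarith
    have hcoer0 : 0 ≤ Θ + -(1 / 2) * J := by linarith
    have h1 : α * (Θ + -(1 / 2) * J) = ISθ - IBθ - Ifθ := by rw [hfθ]; ring
    have h2 : |α| * (Θ + -(1 / 2) * J) ≤ |ISθ| + |IBθ| + |Ifθ| := by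
      calc |α| * (Θ + -(1 / 2) * J) = |α * (Θ + -(1 / 2) * J)| := by
            rw [abs_mul, abs_of_nonneg hcoer0]
        _ = |ISθ - IBθ - Ifθ| := by rw [h1]
        _ ≤ |ISθ - IBθ| + |Ifθ| := abs_sub _ _
        _ ≤ |ISθ| + |IBθ| + |Ifθ| := by linarith [abs_sub ISθ IBθ]
    have h3 : |ISθ| ≤ 80 * β' * R ^ 2 * (4 * z) * T := by
      calc |ISθ| ≤ 80 * β' * R ^ 2 * Real.sqrt Y * T := hSθ
        _ ≤ 80 * β' * R ^ 2 * (4 * z) * T := by gcongr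
    have h4 : |IBθ| ≤ C₄ * (4 * z) * T := by
      calc |IBθ| ≤ C₄ * Real.sqrt Y * T := hBθ
        _ ≤ C₄ * (4 * z) * T := by gcongr
    have h5 : |Ifθ| ≤ φ * (4 * z) := by
      calc |Ifθ| ≤ φ * Real.sqrt D := hPfθ
        _ ≤ φ * (4 * z) := mul_le_mul_of_nonneg_left hsD4 hφ0
    have h6 : 3 / 10 * |α| * Θ ≤ |α| * (Θ + -(1 / 2) * J) := by
      have := mul_le_mul_of_nonneg_left hcoer (abs_nonneg α)
      linarith
    calc 3 / 10 * |α| * T ^ 2 = 3 / 10 * |α| * Θ := by rw [hTΘ]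
      _ ≤ |ISθ| + |IBθ| + |Ifθ| := h6.trans h2
      _ ≤ 80 * β' * R ^ 2 * (4 * z) * T + C₄ * (4 * z) * T + φ * (4 * z) := by linarith
      _ = 4 * φ * z + 4 * A' * z * T := by rw [hA']; ring
  have hgap' : E + Nu ≤ 3 * E := by linarith
  have hZ := coreInverse_absorb' E (E + Nu) T z φ |α| A' B' hz0 hφ0 ha hA'0 hB'0 hzZ hgap' hP1 hP2 hAB hBa
  have h150 : (1500 : ℝ) ^ 2 = 2250000 := by norm_num
  rw [h150]
  linarith

/-! ## Pointwise dictionary -/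

/-- Ground-state conjugation at `λ = 0`: `L(Gu) = G(Δu − ½ ξ·∇u)`. [folklore] -/
theorem strainedVorticityOperator_gauss_mul {u : EuclideanSpace ℝ (Fin 2) → ℝ} (hu : ContDiff ℝ 2 u)
    (ξ : EuclideanSpace ℝ (Fin 2)) :
    strainedVorticityOperator 0 (fun η => gaussVortexProfile η * u η) ξ =
      gaussVortexProfile ξ * (Δ u ξ - (1 / 2 * ξ 0 * fderiv ℝ u ξ (EuclideanSpace.single 0 1) +
        1 / 2 * ξ 1 * fderiv ℝ u ξ (EuclideanSpace.single 1 1))) := by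
  have h0 : ∀ x : EuclideanSpace ℝ (Fin 2), fderiv ℝ gaussVortexProfile x (EuclideanSpace.single 0 (1 : ℝ)) =
      -((1 + 0) * x 0 / 2) * gaussVortexProfile x := by
    intro x; rw [fderiv_gaussVortexProfile_apply, EuclideanSpace.inner_single_right]; simp; ring
  have h1 : ∀ x : EuclideanSpace ℝ (Fin 2), fderiv ℝ gaussVortexProfile x (EuclideanSpace.single 1 (1 : ℝ)) =
      -((1 - 0) * x 1 / 2) * gaussVortexProfile x := by
    intro x; rw [fderiv_gaussVortexProfile_apply, EuclideanSpace.inner_single_right]; simp; ring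
  rw [strainedVorticityOperator_weight_mul contDiff_gaussVortexProfile hu 0 h0 h1 ξ]
  norm_num

/-! ## The assembly -/

/-- **Stub 2 (`stub_coreInverse`) from the registered helpers.** -/
theorem stub_coreInverse :
    ∀ (k : ℕ) (β C_B : ℝ), ∃ (K R₀ δ : ℝ), 0 < K ∧ 0 < R₀ ∧ 0 < δ ∧
      ∀ (α b₁ b₂ R : ℝ) (χ wB : EuclideanSpace ℝ (Fin 2) → ℝ), R₀ ≤ |α| → b₁ ^ 2 + b₂ ^ 2 ≤ β ^ 2 → 1 ≤ R →
        R ≤ |α| ^ δ / K →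
        (ContDiff ℝ ∞ χ ∧ (∀ ξ η, ‖ξ‖ = ‖η‖ → χ ξ = χ η) ∧ (∀ ξ, ‖ξ‖ ≤ R → χ ξ = 1) ∧
          (∀ ξ, 2 * R ≤ ‖ξ‖ → χ ξ = 0) ∧ (∀ ξ, 0 ≤ χ ξ ∧ χ ξ ≤ 1) ∧ (∀ ξ, ‖fderiv ℝ χ ξ‖ ≤ 4 / R)) →
        ContDiff ℝ 2 wB → (∀ ξ, wB (-ξ) = wB ξ) →
        (∀ ξ, |wB ξ| + ‖gradient wB ξ‖ ≤ C_B * (1 + ‖ξ‖) ^ k * gaussVortexProfile ξ) →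
        ∀ u : EuclideanSpace ℝ (Fin 2) → ℝ, ContDiff ℝ 2 u → (∀ ξ, u (-ξ) = u ξ) →
          (∃ M : ℝ, ∀ ξ, |u ξ| ≤ M ∧ ‖fderiv ℝ u ξ‖ ≤ M ∧ ‖fderiv ℝ (fderiv ℝ u) ξ‖ ≤ M) →
          (∫ ξ, gaussVortexProfile ξ * u ξ = 0) →
          let w : EuclideanSpace ℝ (Fin 2) → ℝ := fun η => gaussVortexProfile η * u η;
          let f : EuclideanSpace ℝ (Fin 2) → ℝ := fun ξ => strainedVorticityOperator 0 w ξ +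
              (χ ξ * ⟪toLp 2 ![b₁ * ξ 0 + b₂ * ξ 1, b₂ * ξ 0 - b₁ * ξ 1], gradient w ξ⟫ +
                ⟪gradient χ ξ, toLp 2 ![b₁ * ξ 0 + b₂ * ξ 1, b₂ * ξ 0 - b₁ * ξ 1]⟫ * w ξ) -
            α * (⟪gaussVortexVelocity ξ, gradient w ξ⟫ + ⟪biotSavart2D w ξ, gradient gaussVortexProfile ξ⟫) -
            (⟪biotSavart2D w ξ, gradient wB ξ⟫ + ⟪biotSavart2D wB ξ, gradient w ξ⟫);
          MemGWSobolev w ∧ Integrable (fun ξ => (gaussVortexProfile ξ)⁻¹ * (1 + ‖ξ‖ ^ 2) * f ξ ^ 2) ∧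
            gwSobolevNormSq w ≤ K ^ 2 * ∫ ξ, (gaussVortexProfile ξ)⁻¹ * (1 + ‖ξ‖ ^ 2) * f ξ ^ 2 := by
  intro k β C_B
  obtain ⟨C₃, hC₃, hJb⟩ := lamB_pairing_w_bound k C_B
  obtain ⟨C₄, hC₄, hIb⟩ := lamB_pairing_dtheta_bound k C_B
  refine ⟨1500, (1 + 138 * ((80 * |β| + C₄) * (40 * |β| + C₃)) + (40 * |β| + C₃) ^ 2) ^ 12, 1 / 12,
    by norm_num, by positivity, by norm_num, ?_⟩
  intro α b₁ b₂ R χ wB hα hb hR1 hR hχ hwB hwBe hwBb u hu hue hM hmean w f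
  -- basic regularity facts
  obtain ⟨M, hM'⟩ := hM
  have hM3 : ∃ M : ℝ, ∀ ξ, |u ξ| ≤ M ∧ ‖fderiv ℝ u ξ‖ ≤ M ∧ ‖fderiv ℝ (fderiv ℝ u) ξ‖ ≤ M := ⟨M, hM'⟩
  have hM2 : ∃ M : ℝ, ∀ ξ, |u ξ| ≤ M ∧ ‖fderiv ℝ u ξ‖ ≤ M := ⟨M, fun ξ => ⟨(hM' ξ).1, (hM' ξ).2.1⟩⟩
  have hu1 : ContDiff ℝ 1 u := hu.of_le one_le_two
  have hχ1 : ContDiff ℝ 1 χ := hχ.1.of_le (by exact_mod_cast le_top)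
  have hχc : HasCompactSupport χ := by
    refine HasCompactSupport.intro (isCompact_closedBall (0 : EuclideanSpace ℝ (Fin 2)) (2 * R)) ?_
    intro ξ hξ
    rw [Metric.mem_closedBall, dist_zero_right, not_le] at hξ
    exact hχ.2.2.2.1 ξ hξ.le
  -- the integrability package
  have hint := coreInverse_integrability k C_B α b₁ b₂ χ wB u hχ1 hχc hwB hwBb hu hM3
  obtain ⟨hmem, hIw2, hIDw2, hYsplit, hIΘ, hILw, hILθ, hISw, hISθ, hIRw, hIRθ, hINw, hINθ, hIBw, hIBθ,
    hIf2, hIfw, hIfθ, hPfw, hPfθ⟩ := hint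
  beta_reduce at hmem hIw2 hIDw2 hYsplit hIΘ hILw hILθ hISw hISθ hIRw hIRθ hINw hINθ hIBw hIBθ hIf2 hIfw hIfθ hPfw hPfθ
  -- positivity of `G`
  have hGpos : ∀ ξ : EuclideanSpace ℝ (Fin 2), 0 < gaussVortexProfile ξ := gaussVortexProfile_pos
  have hGne : ∀ ξ : EuclideanSpace ℝ (Fin 2), gaussVortexProfile ξ ≠ 0 := fun ξ => (hGpos ξ).ne'
  have inv_mul_mul_sq : ∀ {a : ℝ}, a ≠ 0 → ∀ b : ℝ, a⁻¹ * (a * b) ^ 2 = a * b ^ 2 := fun ha b => by field_simp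
  have inv_mul_mul_mul : ∀ {a : ℝ}, a ≠ 0 → ∀ b c : ℝ, a⁻¹ * (a * c) * (a * b) = a * c * b := fun ha b c => by field_simp
  have inv_mul_neg_half_mul : ∀ {a : ℝ}, a ≠ 0 → ∀ b c : ℝ, a⁻¹ * (-(a / 2) * c) * b = -(1 / 2) * (c * b) :=
    fun ha b c => by field_simp
  -- (A7) `N = Nu`
  have hNNu : (∫ ξ, (gaussVortexProfile ξ)⁻¹ * (gaussVortexProfile ξ * u ξ) ^ 2) = ∫ ξ, gaussVortexProfile ξ * u ξ ^ 2 := by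
    refine integral_congr_ae (Filter.Eventually.of_forall fun ξ => ?_)
    exact inv_mul_mul_sq (hGne ξ) (u ξ)
  -- (A6) `⟨Lw, w⟩ = −E`, gap, `Y`-control
  obtain ⟨h6a, h6b, h6c⟩ := coreL_energy_gap u hu hM3 hmean
  -- (A4) `⟨v^G·∇w, w⟩ = 0`
  have hRw0 : (∫ ξ, (gaussVortexProfile ξ)⁻¹ * ⟪gaussVortexVelocity ξ, gradient (fun η => gaussVortexProfile η * u η) ξ⟫ * (gaussVortexProfile ξ * u ξ)) = 0 := by
    refine Eq.trans (integral_congr_ae (Filter.Eventually.of_forall fun ξ => ?_)) (coreRotation_local_skew u hu1 hM2)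
    simp only []
    ring
  -- (A5) `⟨(K∗w)·∇G, w⟩ = 0`
  have hwcont : Continuous (fun η => gaussVortexProfile η * u η) := (contDiff_gaussVortexProfile (n := 0)).continuous.mul hu.continuous
  have hwint : Integrable (fun η => gaussVortexProfile η * u η) := by
    refine integrable_of_le_one_add_norm_pow_mul_gauss hwcont (A := M) (N := 0) (fun ξ => ?_)
    rw [Real.norm_eq_abs, abs_mul, abs_of_pos (hGpos ξ), pow_zero, one_mul, mul_comm]
    exact mul_le_mul_of_nonneg_right (hM' ξ).1 (hGpos ξ).le
  have hwbd : ∃ M₀ : ℝ, ∀ ξ, |(fun η => gaussVortexProfile η * u η) ξ| ≤ M₀ * gaussVortexProfile ξ := by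
    refine ⟨M, fun ξ => ?_⟩
    show |gaussVortexProfile ξ * u ξ| ≤ M * gaussVortexProfile ξ
    rw [abs_mul, abs_of_pos (hGpos ξ), mul_comm]
    exact mul_le_mul_of_nonneg_right (hM' ξ).1 (hGpos ξ).le
  have hNw0 : (∫ ξ, (gaussVortexProfile ξ)⁻¹ * ⟪biotSavart2D (fun η => gaussVortexProfile η * u η) ξ, gradient gaussVortexProfile ξ⟫ * (gaussVortexProfile ξ * u ξ)) = 0 := by
    have h := coreBiotSavart_skew (fun η => gaussVortexProfile η * u η) hwcont hwint hwbd
    beta_reduce at h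
    refine Eq.trans (integral_congr_ae (Filter.Eventually.of_forall fun ξ => ?_)) h
    simp only []
    ring
  -- (A3) `⟨Lw, ∂_θw⟩ = 0`
  have hLθ0 : (∫ ξ, (gaussVortexProfile ξ)⁻¹ * strainedVorticityOperator 0 (fun η => gaussVortexProfile η * u η) ξ * fderiv ℝ (fun η => gaussVortexProfile η * u η) ξ (perp ξ)) = 0 := by
    refine Eq.trans (integral_congr_ae (Filter.Eventually.of_forall fun ξ => ?_)) (coreL_angular_pairing_eq_zero u hu hM3)
    beta_reduce
    rw [strainedVorticityOperator_gauss_mul hu ξ, fderiv_gauss_mul_perp (hu.differentiable two_ne_zero) ξ]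
    exact inv_mul_mul_mul (hGne ξ) _ _
  -- (A1) `⟨v^G·∇w, ∂_θw⟩ = Θ`
  have hRθ : (∫ ξ, (gaussVortexProfile ξ)⁻¹ * ⟪gaussVortexVelocity ξ, gradient (fun η => gaussVortexProfile η * u η) ξ⟫ * fderiv ℝ (fun η => gaussVortexProfile η * u η) ξ (perp ξ)) = ∫ ξ, (gaussVortexProfile ξ)⁻¹ * ((8 * Real.pi)⁻¹ * burgersPhi (‖ξ‖ ^ 2 / 4)) * (fderiv ℝ (fun η => gaussVortexProfile η * u η) ξ (perp ξ)) ^ 2 := by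
    refine integral_congr_ae (Filter.Eventually.of_forall fun ξ => ?_)
    beta_reduce
    rw [inner_gaussVortexVelocity_gradient_eq_mul_angularDeriv]
    ring
  -- (A2) `⟨(K∗w)·∇G, ∂_θw⟩ = −½ J`
  have hNθ : (∫ ξ, (gaussVortexProfile ξ)⁻¹ * ⟪biotSavart2D (fun η => gaussVortexProfile η * u η) ξ, gradient gaussVortexProfile ξ⟫ * fderiv ℝ (fun η => gaussVortexProfile η * u η) ξ (perp ξ)) = -(1 / 2) * ∫ ξ, ⟪ξ, biotSavart2D (fun η => gaussVortexProfile η * u η) ξ⟫ * fderiv ℝ (fun η => gaussVortexProfile η * u η) ξ (perp ξ) := by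
    rw [← integral_const_mul]
    refine integral_congr_ae (Filter.Eventually.of_forall fun ξ => ?_)
    beta_reduce
    rw [inner_gradient_gaussVortexProfile]
    exact inv_mul_neg_half_mul (hGne ξ) _ _
  -- rotation coercivity (Biot–Savart part), strain and background bounds
  have hcoer := coreRotation_coercivity u hu hue hM3
  beta_reduce at hcoer
  obtain ⟨hJint, hJ0, hJ⟩ := hcoer
  have hb' : b₁ ^ 2 + b₂ ^ 2 ≤ |β| ^ 2 := by rw [sq_abs]; exact hb
  have hstrain := coreStrain_pairing_bounds b₁ b₂ |β| R χ u (abs_nonneg β) hb' hR1 hχ hu1 hM2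
  beta_reduce at hstrain
  obtain ⟨-, -, hSw, hSθ⟩ := hstrain
  have hBw := hJb wB u hwB hwBe hwBb hu hue hM3
  have hBθ := hIb wB u hwB hwBb hu hM3
  beta_reduce at hBw hBθ
  -- the parameter regime
  obtain ⟨hAB, hBa, ha0⟩ := coreInverse_params |β| C₃ C₄ α R 1500 (abs_nonneg β) hC₃.le hC₄.le (by norm_num) hα hR1 hR
  -- linearity of the two pairings of `f`
  have hlinw : (∫ ξ, (gaussVortexProfile ξ)⁻¹ * (strainedVorticityOperator 0 (fun η => gaussVortexProfile η * u η) ξ + (χ ξ * ⟪toLp 2 ![b₁ * ξ 0 + b₂ * ξ 1, b₂ * ξ 0 - b₁ * ξ 1], gradient (fun η => gaussVortexProfile η * u η) ξ⟫ + ⟪gradient χ ξ, toLp 2 ![b₁ * ξ 0 + b₂ * ξ 1, b₂ * ξ 0 - b₁ * ξ 1]⟫ * (gaussVortexProfile ξ * u ξ)) - α * (⟪gaussVortexVelocity ξ, gradient (fun η => gaussVortexProfile η * u η) ξ⟫ + ⟪biotSavart2D (fun η => gaussVortexProfile η * u η) ξ, gradient gaussVortexProfile ξ⟫) - (⟪biotSavart2D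 (fun η => gaussVortexProfile η * u η) ξ, gradient wB ξ⟫ + ⟪biotSavart2D wB ξ, gradient (fun η => gaussVortexProfile η * u η) ξ⟫)) * (gaussVortexProfile ξ * u ξ)) =
      (∫ ξ, (gaussVortexProfile ξ)⁻¹ * strainedVorticityOperator 0 (fun η => gaussVortexProfile η * u η) ξ * (gaussVortexProfile ξ * u ξ)) + (∫ ξ, (gaussVortexProfile ξ)⁻¹ * (χ ξ * ⟪toLp 2 ![b₁ * ξ 0 + b₂ * ξ 1, b₂ * ξ 0 - b₁ * ξ 1], gradient (fun η => gaussVortexProfile η * u η) ξ⟫ + ⟪gradient χ ξ, toLp 2 ![b₁ * ξ 0 + b₂ * ξ 1, b₂ * ξ 0 - b₁ * ξ 1]⟫ * (gaussVortexProfile ξ * u ξ)) * (gaussVortexProfile ξ * u ξ)) - α * ((∫ ξ, (gaussVortexProfile ξ)⁻¹ * ⟪gaussVortexVelocity ξ, gradient (fun η => gaussVortexProfile η * u η) ξ⟫ * (gaussVortexProfile ξ * u ξ)) + (∫ ξ, (gaussVortexProfile ξ)⁻¹ * ⟪biotSavart2D (fun η => gaussVortexProfile η * u η) ξ, gradient gaussVortexProfile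 ξ⟫ * (gaussVortexProfile ξ * u ξ))) - (∫ ξ, (gaussVortexProfile ξ)⁻¹ * (⟪biotSavart2D (fun η => gaussVortexProfile η * u η) ξ, gradient wB ξ⟫ + ⟪biotSavart2D wB ξ, gradient (fun η => gaussVortexProfile η * u η) ξ⟫) * (gaussVortexProfile ξ * u ξ)) := by
    have e : (∫ ξ, (gaussVortexProfile ξ)⁻¹ * (strainedVorticityOperator 0 (fun η => gaussVortexProfile η * u η) ξ + (χ ξ * ⟪toLp 2 ![b₁ * ξ 0 + b₂ * ξ 1, b₂ * ξ 0 - b₁ * ξ 1], gradient (fun η => gaussVortexProfile η * u η) ξ⟫ + ⟪gradient χ ξ, toLp 2 ![b₁ * ξ 0 + b₂ * ξ 1, b₂ * ξ 0 - b₁ * ξ 1]⟫ * (gaussVortexProfile ξ * u ξ)) - α * (⟪gaussVortexVelocity ξ, gradient (fun η => gaussVortexProfile η * u η) ξ⟫ + ⟪biotSavart2D (fun η => gaussVortexProfile η * u η) ξ, gradient gaussVortexProfile ξ⟫) - (⟪biotSavart2D (fun η => gaussVortexProfile η * u η) ξ, gradient wB ξ⟫ + ⟪biotSavart2D wB ξ,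 gradient (fun η => gaussVortexProfile η * u η) ξ⟫)) * (gaussVortexProfile ξ * u ξ)) =
        ∫ ξ, ((gaussVortexProfile ξ)⁻¹ * strainedVorticityOperator 0 (fun η => gaussVortexProfile η * u η) ξ * (gaussVortexProfile ξ * u ξ) + (gaussVortexProfile ξ)⁻¹ * (χ ξ * ⟪toLp 2 ![b₁ * ξ 0 + b₂ * ξ 1, b₂ * ξ 0 - b₁ * ξ 1], gradient (fun η => gaussVortexProfile η * u η) ξ⟫ + ⟪gradient χ ξ, toLp 2 ![b₁ * ξ 0 + b₂ * ξ 1, b₂ * ξ 0 - b₁ * ξ 1]⟫ * (gaussVortexProfile ξ * u ξ)) * (gaussVortexProfile ξ * u ξ) - α * ((gaussVortexProfile ξ)⁻¹ * ⟪gaussVortexVelocity ξ, gradient (fun η => gaussVortexProfile η * u η) ξ⟫ * (gaussVortexProfile ξ * u ξ) + (gaussVortexProfile ξ)⁻¹ * ⟪biotSavart2D (fun η => gaussVortexProfile η * u η) ξ, gradient gaussVortexProfile ξ⟫ * (gaussVortexProfile ξ * u ξ))) - (gaussVortexProfile ξ)⁻¹ * (⟪biotSavart2D (fun η => gaussVortexProfile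 η * u η) ξ, gradient wB ξ⟫ + ⟪biotSavart2D wB ξ, gradient (fun η => gaussVortexProfile η * u η) ξ⟫) * (gaussVortexProfile ξ * u ξ) := by
      refine integral_congr_ae (Filter.Eventually.of_forall fun ξ => ?_)
      beta_reduce
      ring
    have h12 : Integrable (fun ξ => (gaussVortexProfile ξ)⁻¹ * strainedVorticityOperator 0 (fun η => gaussVortexProfile η * u η) ξ * (gaussVortexProfile ξ * u ξ) + (gaussVortexProfile ξ)⁻¹ * (χ ξ * ⟪toLp 2 ![b₁ * ξ 0 + b₂ * ξ 1, b₂ * ξ 0 - b₁ * ξ 1], gradient (fun η => gaussVortexProfile η * u η) ξ⟫ + ⟪gradient χ ξ, toLp 2 ![b₁ * ξ 0 + b₂ * ξ 1, b₂ * ξ 0 - b₁ * ξ 1]⟫ * (gaussVortexProfile ξ * u ξ)) * (gaussVortexProfile ξ * u ξ)) := hILw.add hISw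
    have h34 : Integrable (fun ξ => (gaussVortexProfile ξ)⁻¹ * ⟪gaussVortexVelocity ξ, gradient (fun η => gaussVortexProfile η * u η) ξ⟫ * (gaussVortexProfile ξ * u ξ) + (gaussVortexProfile ξ)⁻¹ * ⟪biotSavart2D (fun η => gaussVortexProfile η * u η) ξ, gradient gaussVortexProfile ξ⟫ * (gaussVortexProfile ξ * u ξ)) := hIRw.add hINw
    have h34a : Integrable (fun ξ => α * ((gaussVortexProfile ξ)⁻¹ * ⟪gaussVortexVelocity ξ, gradient (fun η => gaussVortexProfile η * u η) ξ⟫ * (gaussVortexProfile ξ * u ξ) + (gaussVortexProfile ξ)⁻¹ * ⟪biotSavart2D (fun η => gaussVortexProfile η * u η) ξ, gradient gaussVortexProfile ξ⟫ * (gaussVortexProfile ξ * u ξ))) := h34.const_mul α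
    have h1234 : Integrable (fun ξ => (gaussVortexProfile ξ)⁻¹ * strainedVorticityOperator 0 (fun η => gaussVortexProfile η * u η) ξ * (gaussVortexProfile ξ * u ξ) + (gaussVortexProfile ξ)⁻¹ * (χ ξ * ⟪toLp 2 ![b₁ * ξ 0 + b₂ * ξ 1, b₂ * ξ 0 - b₁ * ξ 1], gradient (fun η => gaussVortexProfile η * u η) ξ⟫ + ⟪gradient χ ξ, toLp 2 ![b₁ * ξ 0 + b₂ * ξ 1, b₂ * ξ 0 - b₁ * ξ 1]⟫ * (gaussVortexProfile ξ * u ξ)) * (gaussVortexProfile ξ * u ξ) - α * ((gaussVortexProfile ξ)⁻¹ * ⟪gaussVortexVelocity ξ, gradient (fun η => gaussVortexProfile η * u η) ξ⟫ * (gaussVortexProfile ξ * u ξ) + (gaussVortexProfile ξ)⁻¹ * ⟪biotSavart2D (fun η => gaussVortexProfile η * u η) ξ, gradient gaussVortexProfile ξ⟫ * (gaussVortexProfile ξ * u ξ))) := h12.sub h34a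
    rw [e, integral_sub h1234 hIBw, integral_sub h12 h34a, integral_add hILw hISw, integral_const_mul,
      integral_add hIRw hINw]
  have hlinθ : (∫ ξ, (gaussVortexProfile ξ)⁻¹ * (strainedVorticityOperator 0 (fun η => gaussVortexProfile η * u η) ξ + (χ ξ * ⟪toLp 2 ![b₁ * ξ 0 + b₂ * ξ 1, b₂ * ξ 0 - b₁ * ξ 1], gradient (fun η => gaussVortexProfile η * u η) ξ⟫ + ⟪gradient χ ξ, toLp 2 ![b₁ * ξ 0 + b₂ * ξ 1, b₂ * ξ 0 - b₁ * ξ 1]⟫ * (gaussVortexProfile ξ * u ξ)) - α * (⟪gaussVortexVelocity ξ, gradient (fun η => gaussVortexProfile η * u η) ξ⟫ + ⟪biotSavart2D (fun η => gaussVortexProfile η * u η) ξ, gradient gaussVortexProfile ξ⟫) - (⟪biotSavart2D (fun η => gaussVortexProfile η * u η) ξ, gradient wB ξ⟫ + ⟪biotSavart2D wB ξ, gradient (fun η => gaussVortexProfile η * u η) ξ⟫)) * fderiv ℝ (fun η => gaussVortexProfile η * u η) ξ (perp ξ)) =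
      (∫ ξ, (gaussVortexProfile ξ)⁻¹ * strainedVorticityOperator 0 (fun η => gaussVortexProfile η * u η) ξ * fderiv ℝ (fun η => gaussVortexProfile η * u η) ξ (perp ξ)) + (∫ ξ, (gaussVortexProfile ξ)⁻¹ * (χ ξ * ⟪toLp 2 ![b₁ * ξ 0 + b₂ * ξ 1, b₂ * ξ 0 - b₁ * ξ 1], gradient (fun η => gaussVortexProfile η * u η) ξ⟫ + ⟪gradient χ ξ, toLp 2 ![b₁ * ξ 0 + b₂ * ξ 1, b₂ * ξ 0 - b₁ * ξ 1]⟫ * (gaussVortexProfile ξ * u ξ)) * fderiv ℝ (fun η => gaussVortexProfile η * u η) ξ (perp ξ)) - α * ((∫ ξ, (gaussVortexProfile ξ)⁻¹ * ⟪gaussVortexVelocity ξ, gradient (fun η => gaussVortexProfile η * u η) ξ⟫ * fderiv ℝ (fun η => gaussVortexProfile η * u η) ξ (perp ξ)) + (∫ ξ, (gaussVortexProfile ξ)⁻¹ * ⟪biotSavart2D (fun η => gaussVortexProfile η * u η) ξ, gradient gaussVortexProfile ξ⟫ * fderiv ℝ (fun η => gaussVortexProfile η * u η) ξ (perp ξ)))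 - (∫ ξ, (gaussVortexProfile ξ)⁻¹ * (⟪biotSavart2D (fun η => gaussVortexProfile η * u η) ξ, gradient wB ξ⟫ + ⟪biotSavart2D wB ξ, gradient (fun η => gaussVortexProfile η * u η) ξ⟫) * fderiv ℝ (fun η => gaussVortexProfile η * u η) ξ (perp ξ)) := by
    have e : (∫ ξ, (gaussVortexProfile ξ)⁻¹ * (strainedVorticityOperator 0 (fun η => gaussVortexProfile η * u η) ξ + (χ ξ * ⟪toLp 2 ![b₁ * ξ 0 + b₂ * ξ 1, b₂ * ξ 0 - b₁ * ξ 1], gradient (fun η => gaussVortexProfile η * u η) ξ⟫ + ⟪gradient χ ξ, toLp 2 ![b₁ * ξ 0 + b₂ * ξ 1, b₂ * ξ 0 - b₁ * ξ 1]⟫ * (gaussVortexProfile ξ * u ξ)) - α * (⟪gaussVortexVelocity ξ, gradient (fun η => gaussVortexProfile η * u η) ξ⟫ + ⟪biotSavart2D (fun η => gaussVortexProfile η * u η) ξ, gradient gaussVortexProfile ξ⟫) - (⟪biotSavart2D (fun η => gaussVortexProfile η * u η) ξ, gradient wB ξ⟫ + ⟪biotSavart2D wB ξ, gradient (fun η =>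 gaussVortexProfile η * u η) ξ⟫)) * fderiv ℝ (fun η => gaussVortexProfile η * u η) ξ (perp ξ)) =
        ∫ ξ, ((gaussVortexProfile ξ)⁻¹ * strainedVorticityOperator 0 (fun η => gaussVortexProfile η * u η) ξ * fderiv ℝ (fun η => gaussVortexProfile η * u η) ξ (perp ξ) + (gaussVortexProfile ξ)⁻¹ * (χ ξ * ⟪toLp 2 ![b₁ * ξ 0 + b₂ * ξ 1, b₂ * ξ 0 - b₁ * ξ 1], gradient (fun η => gaussVortexProfile η * u η) ξ⟫ + ⟪gradient χ ξ, toLp 2 ![b₁ * ξ 0 + b₂ * ξ 1, b₂ * ξ 0 - b₁ * ξ 1]⟫ * (gaussVortexProfile ξ * u ξ)) * fderiv ℝ (fun η => gaussVortexProfile η * u η) ξ (perp ξ) - α * ((gaussVortexProfile ξ)⁻¹ * ⟪gaussVortexVelocity ξ, gradient (fun η => gaussVortexProfile η * u η) ξ⟫ * fderiv ℝ (fun η => gaussVortexProfile η * u η) ξ (perp ξ) + (gaussVortexProfile ξ)⁻¹ * ⟪biotSavart2D (fun η => gaussVortexProfile η * u η) ξ, gradient gaussVortexProfile ξ⟫ *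 fderiv ℝ (fun η => gaussVortexProfile η * u η) ξ (perp ξ))) - (gaussVortexProfile ξ)⁻¹ * (⟪biotSavart2D (fun η => gaussVortexProfile η * u η) ξ, gradient wB ξ⟫ + ⟪biotSavart2D wB ξ, gradient (fun η => gaussVortexProfile η * u η) ξ⟫) * fderiv ℝ (fun η => gaussVortexProfile η * u η) ξ (perp ξ) := by
      refine integral_congr_ae (Filter.Eventually.of_forall fun ξ => ?_)
      beta_reduce
      ring
    have h12 : Integrable (fun ξ => (gaussVortexProfile ξ)⁻¹ * strainedVorticityOperator 0 (fun η => gaussVortexProfile η * u η) ξ * fderiv ℝ (fun η => gaussVortexProfile η * u η) ξ (perp ξ) + (gaussVortexProfile ξ)⁻¹ * (χ ξ * ⟪toLp 2 ![b₁ * ξ 0 + b₂ * ξ 1, b₂ * ξ 0 - b₁ * ξ 1], gradient (fun η => gaussVortexProfile η * u η) ξ⟫ + ⟪gradient χ ξ, toLp 2 ![b₁ * ξ 0 + b₂ * ξ 1, b₂ * ξ 0 - b₁ * ξ 1]⟫ * (gaussVortexProfile ξ * u ξ)) * fderiv ℝ (fun η => gaussVortexProfile η * u η) ξ (perp ξ))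 := hILθ.add hISθ
    have h34 : Integrable (fun ξ => (gaussVortexProfile ξ)⁻¹ * ⟪gaussVortexVelocity ξ, gradient (fun η => gaussVortexProfile η * u η) ξ⟫ * fderiv ℝ (fun η => gaussVortexProfile η * u η) ξ (perp ξ) + (gaussVortexProfile ξ)⁻¹ * ⟪biotSavart2D (fun η => gaussVortexProfile η * u η) ξ, gradient gaussVortexProfile ξ⟫ * fderiv ℝ (fun η => gaussVortexProfile η * u η) ξ (perp ξ)) := hIRθ.add hINθ
    have h34a : Integrable (fun ξ => α * ((gaussVortexProfile ξ)⁻¹ * ⟪gaussVortexVelocity ξ, gradient (fun η => gaussVortexProfile η * u η) ξ⟫ * fderiv ℝ (fun η => gaussVortexProfile η * u η) ξ (perp ξ) + (gaussVortexProfile ξ)⁻¹ * ⟪biotSavart2D (fun η => gaussVortexProfile η * u η) ξ, gradient gaussVortexProfile ξ⟫ * fderiv ℝ (fun η => gaussVortexProfile η * u η) ξ (perp ξ))) := h34.const_mul α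
    have h1234 : Integrable (fun ξ => (gaussVortexProfile ξ)⁻¹ * strainedVorticityOperator 0 (fun η => gaussVortexProfile η * u η) ξ * fderiv ℝ (fun η => gaussVortexProfile η * u η) ξ (perp ξ) + (gaussVortexProfile ξ)⁻¹ * (χ ξ * ⟪toLp 2 ![b₁ * ξ 0 + b₂ * ξ 1, b₂ * ξ 0 - b₁ * ξ 1], gradient (fun η => gaussVortexProfile η * u η) ξ⟫ + ⟪gradient χ ξ, toLp 2 ![b₁ * ξ 0 + b₂ * ξ 1, b₂ * ξ 0 - b₁ * ξ 1]⟫ * (gaussVortexProfile ξ * u ξ)) * fderiv ℝ (fun η => gaussVortexProfile η * u η) ξ (perp ξ) - α * ((gaussVortexProfile ξ)⁻¹ * ⟪gaussVortexVelocity ξ, gradient (fun η => gaussVortexProfile η * u η) ξ⟫ * fderiv ℝ (fun η => gaussVortexProfile η * u η) ξ (perp ξ) + (gaussVortexProfile ξ)⁻¹ * ⟪biotSavart2D (fun η => gaussVortexProfile η * u η) ξ, gradient gaussVortexProfile ξ⟫ * fderiv ℝ (fun η => gaussVortexProfile η * u η) ξ (perp ξ))) := h12.sub h34a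
    rw [e, integral_sub h1234 hIBθ, integral_sub h12 h34a, integral_add hILθ hISθ, integral_const_mul,
      integral_add hIRθ hINθ]
  have hfw : (∫ ξ, (gaussVortexProfile ξ)⁻¹ * (strainedVorticityOperator 0 (fun η => gaussVortexProfile η * u η) ξ + (χ ξ * ⟪toLp 2 ![b₁ * ξ 0 + b₂ * ξ 1, b₂ * ξ 0 - b₁ * ξ 1], gradient (fun η => gaussVortexProfile η * u η) ξ⟫ + ⟪gradient χ ξ, toLp 2 ![b₁ * ξ 0 + b₂ * ξ 1, b₂ * ξ 0 - b₁ * ξ 1]⟫ * (gaussVortexProfile ξ * u ξ)) - α * (⟪gaussVortexVelocity ξ, gradient (fun η => gaussVortexProfile η * u η) ξ⟫ + ⟪biotSavart2D (fun η => gaussVortexProfile η * u η) ξ, gradient gaussVortexProfile ξ⟫) - (⟪biotSavart2D (fun η => gaussVortexProfile η * u η) ξ, gradient wB ξ⟫ + ⟪biotSavart2D wB ξ, gradient (fun η => gaussVortexProfile η * u η) ξ⟫)) * (gaussVortexProfile ξ * u ξ)) = -(∫ ξ, gaussVortexProfile ξ * ‖fderiv ℝ u ξ‖ ^ 2) + (∫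 ξ, (gaussVortexProfile ξ)⁻¹ * (χ ξ * ⟪toLp 2 ![b₁ * ξ 0 + b₂ * ξ 1, b₂ * ξ 0 - b₁ * ξ 1], gradient (fun η => gaussVortexProfile η * u η) ξ⟫ + ⟪gradient χ ξ, toLp 2 ![b₁ * ξ 0 + b₂ * ξ 1, b₂ * ξ 0 - b₁ * ξ 1]⟫ * (gaussVortexProfile ξ * u ξ)) * (gaussVortexProfile ξ * u ξ)) - α * (0 + 0) - (∫ ξ, (gaussVortexProfile ξ)⁻¹ * (⟪biotSavart2D (fun η => gaussVortexProfile η * u η) ξ, gradient wB ξ⟫ + ⟪biotSavart2D wB ξ, gradient (fun η => gaussVortexProfile η * u η) ξ⟫) * (gaussVortexProfile ξ * u ξ)) := by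
    rw [hlinw, h6a, hRw0, hNw0]
  have hfθ : (∫ ξ, (gaussVortexProfile ξ)⁻¹ * (strainedVorticityOperator 0 (fun η => gaussVortexProfile η * u η) ξ + (χ ξ * ⟪toLp 2 ![b₁ * ξ 0 + b₂ * ξ 1, b₂ * ξ 0 - b₁ * ξ 1], gradient (fun η => gaussVortexProfile η * u η) ξ⟫ + ⟪gradient χ ξ, toLp 2 ![b₁ * ξ 0 + b₂ * ξ 1, b₂ * ξ 0 - b₁ * ξ 1]⟫ * (gaussVortexProfile ξ * u ξ)) - α * (⟪gaussVortexVelocity ξ, gradient (fun η => gaussVortexProfile η * u η) ξ⟫ + ⟪biotSavart2D (fun η => gaussVortexProfile η * u η) ξ, gradient gaussVortexProfile ξ⟫) - (⟪biotSavart2D (fun η => gaussVortexProfile η * u η) ξ, gradient wB ξ⟫ + ⟪biotSavart2D wB ξ, gradient (fun η => gaussVortexProfile η * u η) ξ⟫)) * fderiv ℝ (fun η => gaussVortexProfile η * u η) ξ (perp ξ)) = 0 + (∫ ξ, (gaussVortexProfile ξ)⁻¹ * (χ ξ * ⟪toLp 2 ![b₁ * ξ 0 + b₂ * ξ 1, b₂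 * ξ 0 - b₁ * ξ 1], gradient (fun η => gaussVortexProfile η * u η) ξ⟫ + ⟪gradient χ ξ, toLp 2 ![b₁ * ξ 0 + b₂ * ξ 1, b₂ * ξ 0 - b₁ * ξ 1]⟫ * (gaussVortexProfile ξ * u ξ)) * fderiv ℝ (fun η => gaussVortexProfile η * u η) ξ (perp ξ)) - α * ((∫ ξ, (gaussVortexProfile ξ)⁻¹ * ((8 * Real.pi)⁻¹ * burgersPhi (‖ξ‖ ^ 2 / 4)) * (fderiv ℝ (fun η => gaussVortexProfile η * u η) ξ (perp ξ)) ^ 2) + -(1 / 2) * (∫ ξ, ⟪ξ, biotSavart2D (fun η => gaussVortexProfile η * u η) ξ⟫ * fderiv ℝ (fun η => gaussVortexProfile η * u η) ξ (perp ξ))) - (∫ ξ, (gaussVortexProfile ξ)⁻¹ * (⟪biotSavart2D (fun η => gaussVortexProfile η * u η) ξ, gradient wB ξ⟫ + ⟪biotSavart2D wB ξ, gradient (fun η => gaussVortexProfile η * u η) ξ⟫) * fderiv ℝ (fun η => gaussVortexProfile η * u η) ξ (perp ξ)) := by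
    rw [hlinθ, hLθ0, hRθ, hNθ]
  -- nonnegativity of the basic quantities
  have hE0 : 0 ≤ ∫ ξ, gaussVortexProfile ξ * ‖fderiv ℝ u ξ‖ ^ 2 := integral_nonneg fun ξ => by
    have := hGpos ξ; positivity
  have hNu0 : 0 ≤ ∫ ξ, gaussVortexProfile ξ * u ξ ^ 2 := integral_nonneg fun ξ => by
    have := hGpos ξ; positivity
  have hD0 : 0 ≤ ∫ ξ, (gaussVortexProfile ξ)⁻¹ * ‖gradient (fun η => gaussVortexProfile η * u η) ξ‖ ^ 2 := integral_nonneg fun ξ => by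
    have := hGpos ξ; positivity
  have hΘ0 : 0 ≤ ∫ ξ, (gaussVortexProfile ξ)⁻¹ * ((8 * Real.pi)⁻¹ * burgersPhi (‖ξ‖ ^ 2 / 4)) * (fderiv ℝ (fun η => gaussVortexProfile η * u η) ξ (perp ξ)) ^ 2 := integral_nonneg fun ξ => by
    have := hGpos ξ; have := burgersPhi_pos (‖ξ‖ ^ 2 / 4); positivity
  have hF0 : 0 ≤ ∫ ξ, (gaussVortexProfile ξ)⁻¹ * (1 + ‖ξ‖ ^ 2) * (strainedVorticityOperator 0 (fun η => gaussVortexProfile η * u η) ξ + (χ ξ * ⟪toLp 2 ![b₁ * ξ 0 + b₂ * ξ 1, b₂ * ξ 0 - b₁ * ξ 1], gradient (fun η => gaussVortexProfile η * u η) ξ⟫ + ⟪gradient χ ξ, toLp 2 ![b₁ * ξ 0 + b₂ * ξ 1, b₂ * ξ 0 - b₁ * ξ 1]⟫ * (gaussVortexProfile ξ * u ξ)) - α * (⟪gaussVortexVelocity ξ, gradient (fun η => gaussVortexProfile η * u η) ξ⟫ + ⟪biotSavart2D (fun η => gaussVortexProfile η * u η) ξ, gradient gaussVortexProfile ξ⟫)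 - (⟪biotSavart2D (fun η => gaussVortexProfile η * u η) ξ, gradient wB ξ⟫ + ⟪biotSavart2D wB ξ, gradient (fun η => gaussVortexProfile η * u η) ξ⟫)) ^ 2 := integral_nonneg fun ξ => by
    have := hGpos ξ; positivity
  -- conclude
  have key := coreInverse_bookkeeping _ _ _ _ _ _ _ _ _ _ _ _ _ _ α |β| R C₃ C₄ hNNu hE0 hNu0 hD0 hΘ0 hF0 (abs_nonneg β)
    hC₃.le hC₄.le hR1 hYsplit h6c h6b hfw hfθ hJ0 hJ hSw hSθ hBw hBθ hPfw hPfθ hAB hBa ha0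
  exact ⟨hmem, hIf2, key⟩

end Summit.AnomalousDissipation.AnomalousDissipation.Theorems.MarginalStabilityChainStretchedVortexRows

end
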